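import Summits.QuantumFields.YangMills.Theorems.BalabanUVNodesN08AlphaBlend
import Summits.QuantumFields.YangMills.Theorems.BalabanUVNodesN08AlphaPattern
import Summits.QuantumFields.YangMills.Theorems.BalabanUVNodesN08AlphaHistGeom
import Summits.QuantumFields.YangMills.Theorems.BalabanUVNodesN08AlphaCompactSel

/-!
# Route «BalabanUVNodes», Track-A DAG node N08 = [Balaban1985UV3] — (α) clause, the in-edge sentence (b11‴) CONSTRUCTED, part 5b:
# THE PROFILE OF A HISTORY — amplitudes, the blended abelian configuration, its periodicity, lift and torus plaquette variables

Cell `pub-ymgap`, seat `pub-ymgap-dag-n08-d` gen 5, file F5b (over F5a `…Blend`, F3 `…Pattern`, F4 `…HistGeom`, gen 4's `…CompactSel`).  `bears_on: R4∕N08`;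
filed `--supports stmt-QuantumFields-19910 --as helper`.  Sorry-free, standard axioms.

THE CONSTRUCTION.  Fix `X ∈ 𝔤`, `X ≠ 0`.  For a history `h` of `k ≤ K` steps the real one-form on `ℤ³` is the blend
`potZ = Σ_{j<k} (θ_j − θ_{j+1})∘proj · patPot (L^j) (amp j)` of F3's scale-`j` patterns with F4's cut-offs (`R = 8`, `θ_k ≡ 0`) and the amplitudes
`amp j = C68·g_jp(g_j)·L^{−2j} ∕ (4‖X‖)`; it is periodic with the period of `T_η`, so it descends to the torus one-form `potT` and the PROFILE
`prof = gexpCfg 𝔊 hX potT` (F1), whose lift is `abelCfg X potZ` (`liftCfg_prof`) and whose torus plaquette variables are `gexp (curl potZ)` (`plaqVar_prof`).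
The REGULARITY of the profile (membership in [7]'s closed class `regClassC`) is the companion file `…N08AlphaProfileRegular`.
HONEST FRAMING: a kernel CONSTRUCTION of test configurations; nothing of [B10] ∕ [7] ∕ [4]'s estimates asserted; count-neutral; NOT a discharge of N08.  d = 3
lattice gauge theory on finite tori as printed; nothing about d = 4, the continuum, OS axioms, a mass gap or the Clay problem.
-/

noncomputable section

namespace Summit.QuantumFields.YangMills.Theorems.BalabanUVNodesN08AlphaProfileBuild

open scoped BigOperators Matrix.Norms.L2Operator
open NormedSpace
open Literature.MathematicalPhysics.QuantumFieldTheory.Balaban1983to89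
open Literature.MathematicalPhysics.QuantumFieldTheory.Balaban1983to89.B10 (pFun)
open Literature.MathematicalPhysics.QuantumFieldTheory.Balaban1985CMP102
open Literature.MathematicalPhysics.QuantumFieldTheory.Balaban1985CMP102.Setting
open Summit.QuantumFields.Balaban3D.Carriers
open Summit.QuantumFields.Balaban3D.Proofs.Primitives (AlphaConsts)
open Summit.QuantumFields.Balaban3D.Proofs.LiftBridge (liftCfg)
open Summit.QuantumFields.Balaban3D.Proofs.TorusLift (projSite projSite_add_e)
open Summit.QuantumFields.Balaban3D.Proofs.ScalesArithmetic (gk_pos gk_sq gk_le_one gk_mono)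
open Summit.QuantumFields.Balaban3D.Proofs.CouplingWindow (pFun_pos pFun_antitone)
open Summit.QuantumFields.Balaban3D.Proofs.Run3Collar (tdist_shift_le)
open Summit.QuantumFields.YangMills.Theorems.BalabanUVNodesN08AlphaRegSel (plaqVar)
open Summit.QuantumFields.YangMills.Theorems.BalabanUVNodesN08AlphaCompactSel (regClassC)
open Summit.QuantumFields.YangMills.Theorems.BalabanUVNodesN08AlphaLiftAvgCont (projSite_add_period)
open Summit.QuantumFields.YangMills.Theorems.BalabanUVNodesN08AlphaAbelianLift
open Summit.QuantumFields.YangMills.Theorems.BalabanUVNodesN08AlphaAbelianAverage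
open Summit.QuantumFields.YangMills.Theorems.BalabanUVNodesN08AlphaPattern
open Summit.QuantumFields.YangMills.Theorems.BalabanUVNodesN08AlphaHistGeom
open Summit.QuantumFields.YangMills.Theorems.BalabanUVNodesN08AlphaBlend
open B3Taylor310LocalRemainder (tdist_comm tdist_triangle)
open B7Prop1Explicit (e e_apply)

variable {L : ℕ} (S : Scales L) {G : Type} [GaugeGroup G] [MeasurableSpace G] {𝔊 : GroupModel G} (𝔠 : AlphaConsts L 𝔊.N)

/-! ## §1 Amplitudes -/

/-- `g_jp(g_j)`. [cite: Balaban1985UV3, (7) p.257 + p.273 L13] -/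
def aj (j : ℕ) : ℝ := S.gk j * pFun 𝔠.lane.carrier.b₀ 𝔠.lane.carrier.p₀ (S.gk j)

/-- **THE AMPLITUDE OF THE SCALE-`j` PATTERN**: `amp j = C68·g_jp(g_j)·L^{−2j} ∕ (4‖X‖)` (a quarter of the closed class's plaquette budget, in units of `‖X‖`).
[cite: Balaban1985UV3, (68) p.273] -/
def amp (X : Matrix (Fin 𝔊.N) (Fin 𝔊.N) ℂ) (j : ℕ) : ℝ :=
  𝔠.C68 * aj S 𝔠 j * (((L : ℝ) ^ j)⁻¹) ^ 2 / (4 * ‖X‖)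

/-- `g_jp(g_j) > 0` on the run's scales. [folklore] -/
theorem aj_pos {j : ℕ} (hj : j ≤ S.K) : 0 < aj S 𝔠 j := by
  have hg0 : 0 < S.gk j := gk_pos S j
  have hg1 : S.gk j ≤ 1 := gk_le_one S S.gK_le_one j hj
  exact mul_pos hg0 (pFun_pos _ _ _ 𝔠.b₀_pos hg0 hg1)

/-- **`g_{j+1}p(g_{j+1}) ≤ L·g_jp(g_j)`** on the run's scales (`g_{j+1} = √L·g_j ≤ L·g_j`, `p` antitone on `(0,1]`). [cite: Balaban1985UV3, (7) p.257] -/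
theorem aj_succ_le {j : ℕ} (hj : j + 1 ≤ S.K) : aj S 𝔠 (j + 1) ≤ (L : ℝ) * aj S 𝔠 j := by
  have hg0 : 0 < S.gk j := gk_pos S j
  have hg0' : 0 < S.gk (j + 1) := gk_pos S (j + 1)
  have hg1' : S.gk (j + 1) ≤ 1 := gk_le_one S S.gK_le_one (j + 1) hj
  have hL1 : (1 : ℝ) ≤ L := by exact_mod_cast le_of_lt 𝔠.one_lt_L
  have hmono : S.gk j ≤ S.gk (j + 1) := gk_mono S (Nat.le_succ j)
  -- `g_{j+1} ≤ L g_j` from the squares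
  have hsq : S.gk (j + 1) ^ 2 ≤ ((L : ℝ) * S.gk j) ^ 2 := by
    rw [mul_pow, gk_sq, gk_sq]
    have h0 : 0 ≤ S.g ^ 2 * ((L : ℝ) ^ j * S.ε) := by have := S.ε_pos.le; positivity
    have hLL : (L : ℝ) ≤ (L : ℝ) ^ 2 := by nlinarith
    calc S.g ^ 2 * ((L : ℝ) ^ (j + 1) * S.ε) = (L : ℝ) * (S.g ^ 2 * ((L : ℝ) ^ j * S.ε)) := by ring
      _ ≤ (L : ℝ) ^ 2 * (S.g ^ 2 * ((L : ℝ) ^ j * S.ε)) := mul_le_mul_of_nonneg_right hLL h0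
  have hgL : S.gk (j + 1) ≤ (L : ℝ) * S.gk j := (pow_le_pow_iff_left₀ hg0'.le (by positivity) two_ne_zero).1 hsq
  have hp : pFun 𝔠.lane.carrier.b₀ 𝔠.lane.carrier.p₀ (S.gk (j + 1)) ≤ pFun 𝔠.lane.carrier.b₀ 𝔠.lane.carrier.p₀ (S.gk j) :=
    pFun_antitone 𝔠.b₀_pos.le 𝔠.p₀_pos.le hg0 hmono hg1'
  have hp0 : 0 ≤ pFun 𝔠.lane.carrier.b₀ 𝔠.lane.carrier.p₀ (S.gk (j + 1)) := (pFun_pos _ _ _ 𝔠.b₀_pos hg0' hg1').le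
  unfold aj
  calc S.gk (j + 1) * pFun 𝔠.lane.carrier.b₀ 𝔠.lane.carrier.p₀ (S.gk (j + 1))
      ≤ ((L : ℝ) * S.gk j) * pFun 𝔠.lane.carrier.b₀ 𝔠.lane.carrier.p₀ (S.gk j) := mul_le_mul hgL hp hp0 (by positivity)
    _ = (L : ℝ) * (S.gk j * pFun 𝔠.lane.carrier.b₀ 𝔠.lane.carrier.p₀ (S.gk j)) := by ring

variable {X : Matrix (Fin 𝔊.N) (Fin 𝔊.N) ℂ}

/-- `amp j ≥ 0` (`j ≤ K`). [folklore] -/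
theorem amp_nonneg (hX0 : X ≠ 0) {j : ℕ} (hj : j ≤ S.K) : 0 ≤ amp S 𝔠 X j := by
  unfold amp
  have := (aj_pos S 𝔠 hj).le
  have := 𝔠.C68_pos.le
  have : 0 < ‖X‖ := norm_pos_iff.2 hX0
  positivity

/-- **`amp (j+1) ≤ amp j / L`** (`j + 1 ≤ K`). [folklore] -/
theorem amp_succ_le (hX0 : X ≠ 0) {j : ℕ} (hj : j + 1 ≤ S.K) : amp S 𝔠 X (j + 1) ≤ amp S 𝔠 X j / L := by
  have hL0 : (0 : ℝ) < L := by exact_mod_cast lt_trans zero_lt_one 𝔠.one_lt_L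
  have hX : 0 < ‖X‖ := norm_pos_iff.2 hX0
  have ha := aj_succ_le S 𝔠 hj
  have hC := 𝔠.C68_pos.le
  rw [le_div_iff₀ hL0]
  have hLj : (0 : ℝ) < (L : ℝ) ^ j := by positivity
  calc amp S 𝔠 X (j + 1) * L = 𝔠.C68 * (aj S 𝔠 (j + 1) / L) * (((L : ℝ) ^ j)⁻¹) ^ 2 / (4 * ‖X‖) := by
        unfold amp; rw [pow_succ]; field_simp; ring
    _ ≤ 𝔠.C68 * aj S 𝔠 j * (((L : ℝ) ^ j)⁻¹) ^ 2 / (4 * ‖X‖) := by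
        have : aj S 𝔠 (j + 1) / L ≤ aj S 𝔠 j := by rw [div_le_iff₀ hL0]; linarith
        gcongr
    _ = amp S 𝔠 X j := rfl

/-- **`amp` is antitone on the run's scales.** [folklore] -/
theorem amp_antitone (hX0 : X ≠ 0) {j j' : ℕ} (hjj' : j ≤ j') (hj' : j' ≤ S.K) : amp S 𝔠 X j' ≤ amp S 𝔠 X j := by
  induction hjj' with
  | refl => exact le_rfl
  | @step i hij ih =>
    have hL1 : (1 : ℝ) ≤ L := by exact_mod_cast le_of_lt 𝔠.one_lt_L
    calc amp S 𝔠 X (i + 1) ≤ amp S 𝔠 X i / L := amp_succ_le S 𝔠 hX0 hj'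
      _ ≤ amp S 𝔠 X i := div_le_self (amp_nonneg S 𝔠 hX0 (by omega)) hL1
      _ ≤ amp S 𝔠 X j := ih (by omega)

/-- `2·amp j·‖X‖ = ½·C68·g_jp(g_j)·L^{−2j}` (the closed class's budget). [folklore] -/
theorem two_mul_amp_mul_norm (hX0 : X ≠ 0) (j : ℕ) :
    2 * amp S 𝔠 X j * ‖X‖ = 𝔠.C68 / 2 * aj S 𝔠 j * (((L : ℝ) ^ j)⁻¹) ^ 2 := by
  have hX : ‖X‖ ≠ 0 := norm_ne_zero_iff.2 hX0
  unfold amp; field_simp; ring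

/-! ## §2 The blended potential on `ℤ³`, its periodicity, the torus form and the profile -/

/-- The transition parameter `R = 8` (cut-off width `8·L^{j−1}` at scale `j`). [folklore] -/
def R0 : ℕ := 8

section Potential

variable (X : Matrix (Fin 𝔊.N) (Fin 𝔊.N) ℂ) {k : ℕ} (h : Hist S.P k)

/-- The cut-off weights `ω_j = θ_j − θ_{j+1}` of the history. [folklore] -/
def wgt (j : ℕ) (y : Site S.P 0) : ℝ :=
  Theta 𝔠.lane.carrier.M₁ (rcolOf S 𝔠.lane.carrier) R0 h j y - Theta 𝔠.lane.carrier.M₁ (rcolOf S 𝔠.lane.carrier) R0 h (j + 1) y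

/-- **THE BLENDED POTENTIAL OF THE HISTORY ON `ℤ³`**: `Σ_{j<k} ω_j(proj x)·patPot (L^j) (amp j) (x, μ)`. [folklore] -/
def potZ : B7Prop1Explicit.Site S.P.d → Fin S.P.d → ℝ :=
  blend k (projSite (P := S.P)) (wgt S 𝔠 h) (fun j => patPot (L ^ j) (amp S 𝔠 X j))

/-- Integer labels of a torus site. [folklore] -/
def labZ {S' : Scales L} (y : Site S'.P 0) : B7Prop1Explicit.Site S'.P.d := fun κ => (((y κ).val : ℕ) : ℤ)

/-- `proj (lab y) = y`. [folklore] -/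
theorem projSite_labZ {S' : Scales L} (y : Site S'.P 0) : projSite (labZ y) = y := by
  funext κ; simp [projSite, labZ]

/-- Shifts in two different directions commute. [folklore] -/
theorem shift_comm {S' : Scales L} (y : Site S'.P 0) {μ ν : Fin S'.P.d} (hμν : μ ≠ ν) : (y.shift μ).shift ν = (y.shift ν).shift μ := by
  funext κ
  simp only [Summit.QuantumFields.Balaban3D.Proofs.TorusLift.shift_apply]
  by_cases h1 : κ = μ
  · subst h1; simp [hμν]
  · by_cases h2 : κ = ν
    · subst h2; simp [h1]
    · simp [h1, h2]

/-- The pattern is invariant under shifts all of whose coordinates are multiples of `2M`. [folklore] -/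
theorem patPot_add_of_dvd {d : ℕ} (M : ℕ) (f : ℝ) (x w : B7Prop1Explicit.Site d) (hw : ∀ i, (2 * (M : ℤ)) ∣ w i) (μ : Fin d) :
    patPot M f (x + w) μ = patPot M f x μ := by
  unfold patPot
  congr 1
  refine Finset.sum_congr rfl fun ν _ => ?_
  obtain ⟨c, hc⟩ := hw ν
  rw [Pi.add_apply, hc, triS_add_two_mul]

/-- **THE POTENTIAL IS PERIODIC WITH THE PERIOD OF `T_η`** in every coordinate (`k ≤ m + K`: `2L^j ∣ 2L^{m+K}`). [cite: Balaban1985UV3, p.256 (torus)] -/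
theorem potZ_add_period (hk : k ≤ S.P.m + S.P.K) (x v : B7Prop1Explicit.Site S.P.d) (μ : Fin S.P.d) :
    potZ S 𝔠 X h (x + (S.P.sitesPerDir 0 : ℤ) • v) μ = potZ S 𝔠 X h x μ := by
  unfold potZ blend
  refine Finset.sum_congr rfl fun j hj => ?_
  rw [Finset.mem_range] at hj
  rw [projSite_add_period]
  congr 1
  refine patPot_add_of_dvd (L ^ j) _ x _ (fun i => ?_) μ
  rw [Pi.smul_apply, smul_eq_mul]
  refine Dvd.dvd.mul_right ?_ _
  -- `2 L^j ∣ |T_η| = 2 L^{m+K}`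
  have hP : S.P.sitesPerDir 0 = 2 * L ^ (S.P.m + S.P.K) := by simp [Params.sitesPerDir]; rfl
  rw [hP]
  push_cast
  exact mul_dvd_mul_left 2 (pow_dvd_pow (L : ℤ) (by omega))

/-- Reduction of labels: `lab (proj y) = y + |T_η|·v` for some integer vector `v`. [folklore] -/
theorem labZ_projSite_eq {S' : Scales L} (y : B7Prop1Explicit.Site S'.P.d) :
    ∃ v : B7Prop1Explicit.Site S'.P.d, labZ (projSite (P := S'.P) y) = y + (S'.P.sitesPerDir 0 : ℤ) • v := by
  refine ⟨fun κ => -(y κ / (S'.P.sitesPerDir 0 : ℤ)), funext fun κ => ?_⟩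
  simp only [labZ, projSite, Pi.add_apply, Pi.smul_apply, smul_eq_mul, ZMod.val_intCast]
  linarith [Int.emod_def (y κ) (S'.P.sitesPerDir 0 : ℤ)]

/-- **`potZ (lab (proj y)) = potZ y`.** [folklore] -/
theorem potZ_labZ_projSite (hk : k ≤ S.P.m + S.P.K) (y : B7Prop1Explicit.Site S.P.d) (μ : Fin S.P.d) :
    potZ S 𝔠 X h (labZ (projSite (P := S.P) y)) μ = potZ S 𝔠 X h y μ := by
  obtain ⟨v, hv⟩ := labZ_projSite_eq y
  rw [hv, potZ_add_period S 𝔠 X h hk]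

/-- **THE TORUS ONE-FORM** of the history: `b ↦ potZ (lab b₋, dir b)`. [folklore] -/
def potT : PBond S.P 0 → ℝ := fun b => potZ S 𝔠 X h (labZ b.src) b.dir

variable {X} (hX : X ∈ 𝔊.lie)

/-- **THE PROFILE OF THE HISTORY**: the torus configuration `b ↦ gexp (potT b)` of the group as printed. [cite: Balaban1985UV3, p.256] -/
def prof : GaugeField S.P 0 G := gexpCfg 𝔊 hX (potT S 𝔠 X h)

/-- **THE LIFT OF THE PROFILE IS THE ABELIAN CONFIGURATION OF `potZ`.** [cite: Balaban1985UV3, p.256] -/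
theorem liftCfg_prof (hk : k ≤ S.P.m + S.P.K) : liftCfg 𝔊 (prof S 𝔠 h hX) = abelCfg X (potZ S 𝔠 X h) := by
  unfold prof
  rw [liftCfg_gexpCfg]
  congr 1
  funext y κ
  exact potZ_labZ_projSite S 𝔠 X h hk y κ

/-- **THE TORUS PLAQUETTE VARIABLES OF THE PROFILE ARE `gexp` OF THE CURL OF `potZ`** (both orientations). [cite: Balaban1985Averaging, (9) p.18] -/
theorem plaqVar_prof (hk : k ≤ S.P.m + S.P.K) (y : Site S.P 0) (μ ν : Fin S.P.d) :
    plaqVar (prof S 𝔠 h hX) y μ ν = gexp 𝔊 hX (curl (potZ S 𝔠 X h) (labZ y) μ ν) := by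
  have hsh : ∀ (y : Site S.P 0) (μ κ : Fin S.P.d), potT S 𝔠 X h ⟨y.shift μ, κ⟩ = potZ S 𝔠 X h (labZ y + e μ) κ := by
    intro y μ κ
    show potZ S 𝔠 X h (labZ (y.shift μ)) κ = _
    rw [← potZ_labZ_projSite S 𝔠 X h hk (labZ y + e μ) κ, projSite_add_e, projSite_labZ]
  have h0 : ∀ κ, potT S 𝔠 X h ⟨y, κ⟩ = potZ S 𝔠 X h (labZ y) κ := fun κ => rfl
  unfold plaqVar
  simp only [prof, gexpCfg, gexp_inv, gexp_add, hsh, h0]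
  congr 1

/-- Hence `dist1` of a torus plaquette of the profile is at most `|curl potZ|·‖X‖`. [cite: Balaban1985Averaging, (19)+(24) p.21] -/
theorem dist1_plaqVar_prof_le (hk : k ≤ S.P.m + S.P.K) (y : Site S.P 0) (μ ν : Fin S.P.d) :
    dist1 (plaqVar (prof S 𝔠 h hX) y μ ν) ≤ |curl (potZ S 𝔠 X h) (labZ y) μ ν| * ‖X‖ := by
  rw [plaqVar_prof S 𝔠 h hX hk, 𝔊.dist1_eq, UnitaryModel.opDist1, rho_gexp]
  exact norm_exp_real_smul_sub_one_le (Summit.QuantumFields.Balaban3D.Proofs.GroupModelSkew.conjTranspose_eq_neg_of_mem_lie 𝔊 hX) _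

end Potential

end Summit.QuantumFields.YangMills.Theorems.BalabanUVNodesN08AlphaProfileBuild

end
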